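import Summits.Ventures.PercRepro.MSTightRestriction
import Summits.Ventures.PercRepro.MSTightTopGround
import Summits.Ventures.PercRepro.MSTightTightCaseGround
import Summits.Ventures.PercRepro.MSTightAdjoin

/-!
# Instances of (R*-M) on a ground set: projection, restriction, the landed reductions, and the
# data at an outside vertex ((F5)–(F7) of Addendum 37)

Dossier proofs/MINE1-theoremS.md, Addendum 37 §1, (F2)–(F7), and proofs/MINE1-RSTARM-PROOF.md
§0–§1. An **instance** `RInst S L' T u` on the ground set `S` is the data of the statement (R*-M):
`L'` a down-set of subsets of `S` containing every singleton of `S` but not `S`; `T` a nonempty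
family of subsets of `S` with `S ∖ y ∈ L'` for every member (`T ⊆ U`); at most `|T| + 1` faces
(the members of `L'` below a member; (Cnt)); `u ⊆ S` with `u ∉ L'`, `S ∖ u ∈ L'` (`u ∈ U ∖ L'`);
(Sig) and (AO). A **witness** is a member of `T` lying in `L'`; the statement (R*-M) proper is that
every instance has one.

This module collects, in the vocabulary of the structure:
* the landed reductions — (F2) `RInst.card_faces`, `RInst.mem_of_compl_mem` (T = U ∩ ↓T);
  (F3) `RInst.exists_witness_of_tight`; (F4) `RInst.exists_witness_of_eq`; the inside case (F6)
  `RInst.exists_witness_of_forall_subset` through the restriction `RInst.restrict` (an instance on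
  the ground set `u`, MSTightRestriction.lean) and (F4) on a ground set;
* (F5) the projection along an outside vertex `m` with `{m} ∉ U`: `RInst.proj` is an instance on
  `S.erase m`; and the singleton case `RInst.exists_witness_of_erase_mem` (`{m} ∈ U` gives a
  witness at once);
* the residue case: a non-tight `T` has `T \\ T` = the faces (`RInst.diffs_eq_faces`), and every
  outside vertex `m ∈ ⋃T` with `{m} ∉ U` is a NON-TIGHTENING direction with nonempty partner
  family (`RInst.nonTightening`, `RInst.partner_nonempty`; (F2) for the projected instance);
* (F7): `u ∩ R*(K_m) ∈ K_m` (`RInst.inter_Rstar_mem_partner`) and every minimal member of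
  `U` inside `u` is a partner member inside `R*(K_m)` (`RInst.mem_partner_and_subset_Rstar_of_minimal`),
  by the adjoining mechanism of MSTightAdjoin.lean.
-/

namespace PercRepro.MSTight

open Finset
open scoped FinsetFamily

variable {α : Type*} [DecidableEq α]

/-- An instance of the statement (R*-M) on the ground set `S` (Addendum 37 §1). -/
structure RInst (S : Finset α) (L' T : Finset (Finset α)) (u : Finset α) : Prop where
  /-- `L'` is a down-set. -/
  hdown : ∀ w ∈ L', ∀ w', w' ⊆ w → w' ∈ L'
  /-- `L'` consists of subsets of `S`. -/
  hLS : ∀ w ∈ L', w ⊆ S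
  /-- `L'` contains every singleton of `S`. -/
  hsing : ∀ a ∈ S, ({a} : Finset α) ∈ L'
  /-- `S ∉ L'`. -/
  hS : S ∉ L'
  /-- `T` is nonempty. -/
  hne : T.Nonempty
  /-- `T` consists of subsets of `S`. -/
  hTS : ∀ y ∈ T, y ⊆ S
  /-- `T ⊆ U`: the `S`-complement of every member lies in `L'`. -/
  hTU : ∀ y ∈ T, S \ y ∈ L'
  /-- (Cnt): at most `|T| + 1` faces. -/
  hcnt : (L'.filter fun w => ∃ y ∈ T, w ⊆ y).card ≤ T.card + 1
  /-- `u ⊆ S`. -/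
  huS : u ⊆ S
  /-- `u ∉ L'`. -/
  hu : u ∉ L'
  /-- `u ∈ U`. -/
  huU : S \ u ∈ L'
  /-- (Sig): every `v ∈ L'` inside `u` has `u ∖ v ∈ L'` or lies below a member. -/
  hsig : ∀ v ∈ L', v ⊆ u → u \ v ∈ L' ∨ ∃ y ∈ T, v ⊆ y
  /-- (AO): some `v₀ ∈ L'` inside `u` with `u ∖ v₀ ∈ L'` lies below no member. -/
  hao : ∃ v₀ ∈ L', v₀ ⊆ u ∧ u \ v₀ ∈ L' ∧ ∀ y ∈ T, ¬ v₀ ⊆ y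

namespace RInst

variable {S u : Finset α} {L' T : Finset (Finset α)}

/-- `∅ ∈ L'`. -/
theorem empty_mem (h : RInst S L' T u) : (∅ : Finset α) ∈ L' :=
  h.hdown _ h.huU _ (empty_subset _)

/-- The differences of `T` are faces. -/
theorem diffs_subset_faces (h : RInst S L' T u) :
    T \\ T ⊆ L'.filter fun w => ∃ y ∈ T, w ⊆ y :=
  diffs_subset_faces_ground h.hdown h.hTS h.hTU

/-- **(F2).** The slack is exactly one. -/
theorem card_faces (h : RInst S L' T u) :
    (L'.filter fun w => ∃ y ∈ T, w ⊆ y).card = T.card + 1 :=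
  card_faces_eq_succ_ground h.hdown h.hne h.hTS h.hTU h.hcnt u h.huS h.hu h.hsig h.hao

/-- **(F2).** `T = U ∩ ↓T`. -/
theorem mem_of_compl_mem (h : RInst S L' T u) {z : Finset α} (hzS : z ⊆ S) (hz : S \ z ∈ L')
    (hzT : ∃ y ∈ T, z ⊆ y) : z ∈ T :=
  mem_of_compl_mem_of_exists_subset_ground h.hdown h.hTS h.hTU h.hcnt u h.huS h.hu h.hsig h.hao
    hzS hz hzT

/-- `u` is not a face. -/
theorem not_subset_of_mem (h : RInst S L' T u) {y : Finset α} (hy : y ∈ T) : ¬ u ⊆ y := by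
  obtain ⟨v₀, -, hv₀u, -, hv₀T⟩ := h.hao
  exact fun hsub => hv₀T y hy (hv₀u.trans hsub)

/-- `u` meets every member of `T`. -/
theorem not_disjoint (h : RInst S L' T u) {y : Finset α} (hy : y ∈ T) : ¬ Disjoint u y := by
  intro hdis
  exact h.hu (h.hdown _ (h.hTU y hy) u (subset_sdiff.2 ⟨h.huS, hdis⟩))

/-- **(F3).** A tight instance has a witness inside `u`. -/
theorem exists_witness_of_tight [Fintype α] (h : RInst S L' T u) (hF : Tight T) :
    ∃ y ∈ T, y ⊆ u ∧ y ∈ L' :=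
  exists_mem_of_tight_ground h.hdown h.hsing hF h.hne h.hTS h.hTU h.card_faces u h.huS h.hu h.huU
    h.hsig h.hao

/-- **(F4).** An instance with `u = S` has a witness. -/
theorem exists_witness_of_eq (h : RInst S L' T u) (huS : u = S) : ∃ y ∈ T, y ∈ L' := by
  subst huS
  refine exists_mem_of_ground h.hdown h.hsing h.hS h.hne h.hTS h.hTU h.hcnt ?_ h.hao
  intro v hv hvu
  exact h.hsig v hv hvu

/-- **The restriction to `u`** is an instance on the ground set `u`. -/
theorem restrict (h : RInst S L' T u) :
    RInst u (L'.filter fun w => w ⊆ u) (T.image fun y => y ∩ u) u where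
  hdown := hdown_restrict h.hdown
  hLS := fun w hw => (mem_filter.1 hw).2
  hsing := fun a ha => mem_filter.2 ⟨h.hsing a (h.huS ha), singleton_subset_iff.2 ha⟩
  hS := fun hu => h.hu (mem_filter.1 hu).1
  hne := h.hne.image _
  hTS := fun y hy => by obtain ⟨t, -, rfl⟩ := mem_image.1 hy; exact inter_subset_right
  hTU := hTU_restrict h.hdown h.huS h.hTU
  hcnt := hcnt_restrict h.hdown h.hTS h.hTU h.hcnt
  huS := subset_refl u
  hu := fun hu => h.hu (mem_filter.1 hu).1
  huU := by rw [Finset.sdiff_self]; exact mem_filter.2 ⟨h.empty_mem, empty_subset _⟩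
  hsig := hsig_restrict h.hsig
  hao := hao_restrict h.hao

/-- **(F6).** If every member lies inside `u`, there is a witness. -/
theorem exists_witness_of_forall_subset (h : RInst S L' T u) (hTu : ∀ y ∈ T, y ⊆ u) :
    ∃ y ∈ T, y ∈ L' := by
  obtain ⟨y, hy, hyL⟩ := h.restrict.exists_witness_of_eq rfl
  obtain ⟨t, ht, rfl⟩ := mem_image.1 hy
  rw [inter_eq_left.2 (hTu t ht)] at hyL
  exact ⟨t, ht, (mem_filter.1 hyL).1⟩

/-- **The singleton case.** If `{m} ∈ U` for some outside vertex `m` (`S.erase m ∈ L'`), there is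
a witness: `{m}` itself when `m` lies in a member, and otherwise every member lies in
`S.erase m ∈ L'`. -/
theorem exists_witness_of_erase_mem (h : RInst S L' T u) {m : α} (hmS : m ∈ S)
    (hm : S.erase m ∈ L') : ∃ y ∈ T, y ∈ L' := by
  by_cases hmT : ∃ y ∈ T, m ∈ y
  · obtain ⟨y, hy, hmy⟩ := hmT
    refine ⟨{m}, h.mem_of_compl_mem (singleton_subset_iff.2 hmS) ?_ ⟨y, hy, singleton_subset_iff.2 hmy⟩,
      h.hsing m hmS⟩
    rwa [sdiff_singleton_eq_erase]
  · push Not at hmT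
    obtain ⟨y, hy⟩ := h.hne
    refine ⟨y, hy, h.hdown _ hm _ ?_⟩
    intro a ha
    exact mem_erase.2 ⟨fun hm' => hmT y hy (hm' ▸ ha), h.hTS y hy ha⟩

/-- The faces of the projected data along `m` are the faces avoiding `m`. -/
theorem faces_proj_eq (L' T : Finset (Finset α)) (m : α) :
    ((L'.filter fun w => m ∉ w).filter fun w => ∃ y ∈ proj m T, w ⊆ y) =
      (L'.filter fun w => ∃ y ∈ T, w ⊆ y).filter fun w => m ∉ w := by
  ext w
  simp only [mem_filter, mem_proj]
  constructor
  · rintro ⟨⟨hw, hmw⟩, y, ⟨t, ht, rfl⟩, hwy⟩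
    exact ⟨⟨hw, t, ht, hwy.trans (erase_subset m t)⟩, hmw⟩
  · rintro ⟨⟨hw, t, ht, hwt⟩, hmw⟩
    exact ⟨⟨hw, hmw⟩, t.erase m, ⟨t, ht, rfl⟩, subset_erase.2 ⟨hwt, hmw⟩⟩

/-- **(F5).** The projection along an outside vertex `m` with `{m} ∉ U` is an instance on the
ground set `S.erase m`. -/
theorem proj (h : RInst S L' T u) {m : α} (hmu : m ∉ u) (hm : S.erase m ∉ L') :
    RInst (S.erase m) (L'.filter fun w => m ∉ w) (PercRepro.MSTight.proj m T) u where
  hdown := by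
    intro w hw w' hw'
    rw [mem_filter] at hw ⊢
    exact ⟨h.hdown w hw.1 w' hw', fun hm' => hw.2 (hw' hm')⟩
  hLS := fun w hw => subset_erase.2 ⟨h.hLS w (mem_filter.1 hw).1, (mem_filter.1 hw).2⟩
  hsing := fun a ha => mem_filter.2 ⟨h.hsing a (mem_erase.1 ha).2,
    fun h' => (mem_erase.1 ha).1 (mem_singleton.1 h').symm⟩
  hS := fun h' => hm (mem_filter.1 h').1
  hne := h.hne.image _
  hTS := fun y hy => by
    obtain ⟨t, ht, rfl⟩ := mem_proj.1 hy
    exact erase_subset_erase m (h.hTS t ht)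
  hTU := fun y hy => by
    obtain ⟨t, ht, rfl⟩ := mem_proj.1 hy
    refine mem_filter.2 ⟨h.hdown _ (h.hTU t ht) _ ?_, fun h' => (mem_sdiff.1 h').1 |> fun h'' => (mem_erase.1 h'').1 rfl⟩
    intro a ha
    rw [mem_sdiff, mem_erase, mem_erase] at ha
    exact mem_sdiff.2 ⟨ha.1.2, fun h' => ha.2 ⟨ha.1.1, h'⟩⟩
  hcnt := by
    rw [faces_proj_eq]
    exact card_filter_le_card_proj_add_one h.diffs_subset_faces h.hcnt
  huS := subset_erase.2 ⟨h.huS, hmu⟩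
  hu := fun h' => h.hu (mem_filter.1 h').1
  huU := by
    rw [erase_sdiff_comm]
    exact mem_filter.2 ⟨h.hdown _ h.huU _ (erase_subset _ _), notMem_erase m _⟩
  hsig := by
    intro v hv hvu
    rcases h.hsig v (mem_filter.1 hv).1 hvu with h' | ⟨y, hy, hvy⟩
    · exact Or.inl (mem_filter.2 ⟨h', fun hm' => hmu (mem_sdiff.1 hm').1⟩)
    · exact Or.inr ⟨y.erase m, mem_proj.2 ⟨y, hy, rfl⟩,
        subset_erase.2 ⟨hvy, fun hm' => hmu (hvu hm')⟩⟩
  hao := by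
    obtain ⟨v₀, hv₀, hv₀u, hv₀c, hv₀T⟩ := h.hao
    refine ⟨v₀, mem_filter.2 ⟨hv₀, fun hm' => hmu (hv₀u hm')⟩, hv₀u,
      mem_filter.2 ⟨hv₀c, fun hm' => hmu (mem_sdiff.1 hm').1⟩, ?_⟩
    intro y hy hsub
    obtain ⟨t, ht, rfl⟩ := mem_proj.1 hy
    exact hv₀T t ht (hsub.trans (erase_subset m t))

/-- **The residue case.** A non-tight instance has `T \\ T` = the faces, with `|T \\ T| = |T| + 1`. -/
theorem diffs_eq_faces (h : RInst S L' T u) (hnt : ¬ Tight T) :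
    T \\ T = L'.filter fun w => ∃ y ∈ T, w ⊆ y := by
  have h1 : T.card ≤ (T \\ T).card := card_le_card_diffs T
  have h2 : (T \\ T).card ≤ (L'.filter fun w => ∃ y ∈ T, w ⊆ y).card :=
    card_le_card h.diffs_subset_faces
  have h3 := h.card_faces
  have h4 : (T \\ T).card ≠ T.card := hnt
  exact eq_of_subset_of_card_le h.diffs_subset_faces (by omega)

/-- In the residue case, `|T \\ T| = |T| + 1`. -/
theorem card_diffs (h : RInst S L' T u) (hnt : ¬ Tight T) : (T \\ T).card = T.card + 1 := by
  rw [h.diffs_eq_faces hnt]; exact h.card_faces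

/-- **(F5), the second half — the count.** In the residue case, for an outside vertex `m` with
`{m} ∉ U`, the differences avoiding `m` number `|proj m T| + 1` ((F2) for the projected instance). -/
theorem card_diffsX (h : RInst S L' T u) (hnt : ¬ Tight T) {m : α}
    (hmu : m ∉ u) (hm : S.erase m ∉ L') :
    (diffsX m T).card = (PercRepro.MSTight.proj m T).card + 1 := by
  have := (h.proj hmu hm).card_faces
  rw [faces_proj_eq, ← h.diffs_eq_faces hnt, diffs_filter_notMem] at this
  exact this

/-- In the residue case, for an outside vertex `m` with `{m} ∉ U`: `Y ⊆ X` (the differences of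
the projection are faces of the projected instance, i.e. differences avoiding `m`). -/
theorem diffsY_subset_diffsX (h : RInst S L' T u) (hnt : ¬ Tight T) {m : α}
    (hmu : m ∉ u) (hm : S.erase m ∉ L') : diffsY m T ⊆ diffsX m T := by
  have h1 := (h.proj hmu hm).diffs_subset_faces
  rw [faces_proj_eq, ← h.diffs_eq_faces hnt, diffs_filter_notMem, diffs_proj_eq] at h1
  exact subset_union_right.trans h1

/-- **(F5), the second half.** In the residue case, every outside vertex `m` with `{m} ∉ U` is a
non-tightening direction of `T`: the `m`-edges of `T \\ T` number exactly `|partner m T|`. -/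
theorem nonTightening (h : RInst S L' T u) (hnt : ¬ Tight T) {m : α}
    (hmu : m ∉ u) (hm : S.erase m ∉ L') :
    (diffsX m T ∩ diffsY m T).card = (partner m T).card := by
  have hX := h.card_diffsX hnt hmu hm
  have hXY : diffsX m T ∩ diffsY m T = diffsY m T :=
    inter_eq_right.2 (h.diffsY_subset_diffsX hnt hmu hm)
  have h1 := card_diffs_eq_card_X_add_card_Y m T
  have h2 := card_eq_card_proj_add_card_partner m T
  have h3 := h.card_diffs hnt
  rw [hXY]; omega

/-- In the residue case, `{m} ∈ T \\ T` for every vertex `m` of a member. -/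
theorem singleton_mem_diffs (h : RInst S L' T u) (hnt : ¬ Tight T) {m : α}
    {y : Finset α} (hy : y ∈ T) (hmy : m ∈ y) : ({m} : Finset α) ∈ T \\ T := by
  rw [h.diffs_eq_faces hnt]
  exact mem_filter.2 ⟨h.hsing m (h.hTS y hy hmy), y, hy, singleton_subset_iff.2 hmy⟩

/-- In the residue case, an outside vertex `m ∈ ⋃T` with `{m} ∉ U` has a nonempty partner
family. -/
theorem partner_nonempty (h : RInst S L' T u) (hnt : ¬ Tight T) {m : α}
    (hmu : m ∉ u) (hm : S.erase m ∉ L') {y : Finset α} (hy : y ∈ T) (hmy : m ∈ y) :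
    (partner m T).Nonempty := by
  have hY : (∅ : Finset α) ∈ diffsY m T :=
    mem_diffsY_iff.2 ⟨notMem_empty m, by simpa using h.singleton_mem_diffs hnt hy hmy⟩
  have hε := h.nonTightening hnt hmu hm
  have hX : (∅ : Finset α) ∈ diffsX m T :=
    mem_diffsX_iff.2 ⟨mem_diffs.2 ⟨y, hy, y, hy, Finset.sdiff_self y⟩, notMem_empty m⟩
  have hpos : 0 < (diffsX m T ∩ diffsY m T).card := card_pos.2 ⟨∅, mem_inter.2 ⟨hX, hY⟩⟩
  rw [← card_pos]; omega

/-- A partner member is a member of `T`. -/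
theorem mem_of_mem_partner {m : α} {k : Finset α} (hk : k ∈ partner m T) : k ∈ T :=
  (mem_part0.1 (mem_inter.1 hk).1).1

/-- In the residue case, `y \ s` is a difference for every member `y` and every `s` with
`S \ s ∈ L'` (the adjoining hypothesis of MSTightAdjoin.lean). -/
theorem sdiff_mem_diffs (h : RInst S L' T u) (hnt : ¬ Tight T) {y s : Finset α} (hy : y ∈ T)
    (hs : S \ s ∈ L') : y \ s ∈ T \\ T := by
  rw [h.diffs_eq_faces hnt]
  exact mem_filter.2 ⟨h.hdown _ hs _ (sdiff_subset_sdiff (h.hTS y hy) (subset_refl _)), y, hy,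
    sdiff_subset⟩

/-- **(F7).** In the residue case, at an outside vertex `m ∈ ⋃T` with `{m} ∉ U`:
`u ∩ R*(K_m) ∈ K_m` (so `T` has a member inside `u`). -/
theorem inter_Rstar_mem_partner [Fintype α] (h : RInst S L' T u) (hnt : ¬ Tight T) {m : α}
    (hmu : m ∉ u) (hm : S.erase m ∉ L') {y : Finset α} (hy : y ∈ T) (hmy : m ∈ y) :
    u ∩ Rstar (partner m T) ∈ partner m T := by
  refine inter_Rstar_mem_partner_of_adjoin (S := {u}) (h.nonTightening hnt hmu hm)
    (h.partner_nonempty hnt hmu hm hy hmy)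
    (fun s hs => by rw [mem_singleton] at hs; subst hs; exact hmu) ?_ (mem_singleton_self u)
  intro s hs y' hy' _
  rw [mem_singleton] at hs; subst hs
  exact h.sdiff_mem_diffs hnt hy' h.huU

/-- **(F7), the minimal members.** In the residue case, at an outside vertex `m ∈ ⋃T` with
`{m} ∉ U`, every minimal member `z` of `U` inside `u` is a partner member inside `R*(K_m)`. -/
theorem mem_partner_and_subset_Rstar_of_minimal [Fintype α] (h : RInst S L' T u) (hnt : ¬ Tight T)
    {m : α} (hmu : m ∉ u) (hm : S.erase m ∉ L') {y : Finset α} (hy : y ∈ T) (hmy : m ∈ y)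
    {z : Finset α} (hzu : z ⊆ u) (hz : S \ z ∈ L')
    (hmin : ∀ x, x ⊆ u → S \ x ∈ L' → x ⊆ z → x = z) :
    z ∈ partner m T ∧ z ⊆ Rstar (partner m T) := by
  refine mem_partner_and_subset_Rstar_of_adjoin_of_minimal (S := {z}) (h.nonTightening hnt hmu hm)
    (h.partner_nonempty hnt hmu hm hy hmy)
    (fun s hs => by rw [mem_singleton] at hs; subst hs; exact fun h' => hmu (hzu h')) ?_
    (mem_singleton_self z) ?_
  · intro s hs y' hy' _
    rw [mem_singleton] at hs; subst hs
    exact h.sdiff_mem_diffs hnt hy' hz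
  · intro k hk hkz
    exact hmin k (hkz.trans hzu) (h.hTU k (mem_of_mem_partner hk)) hkz

end RInst

end PercRepro.MSTight
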